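import Mathlib.LinearAlgebra.Matrix.Adjugate
import Mathlib.LinearAlgebra.Matrix.SpecialLinearGroup
import Mathlib.Tactic.FinCases
import Mathlib.Tactic.LinearCombination
import Mathlib.Tactic.Linarith
import Mathlib.Tactic.Positivity
import HarnessLib

/-!
# Orlov's group `U(E × Ê)` of isometric automorphisms for an elliptic curve with complex multiplication:
# the `2 × 2` matrix model and `U = μ · SL₂(ℤ)`

Venture cell `pub-hsemireg` (Lean root `Summits/Ventures/HSemireg/`), literature seat
`lit-w-polishchuk-orlov`: the KERNEL leg of the cell's auxiliary computation "(Q1)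
`U(E_K × Ê_K) = μ_K · SL₂(ℤ)`" (locator sheet `widen/LIT-W/LITW-POLISHCHUK-ORLOV-LOCATOR-SHEET.md`, (Q1);
used for the autoequivalence frames of `D^b(E_Kⁿ)`; so far pencil ×1 + machine ×3, never a quotation).
Placed under the venture root, not under `Literature/`, because the CM statement is DERIVED here: only the
definition (Def. 2.17) and the case `End = ℤ` (Ex. 4.16) are printed. Companion file
`OrlovIsometryGroupCMQuadratic.lean`: the instances `End(E) = ℤ[ω]` (every imaginary-quadratic order; the
cell anchors `E_ω`, `E_i` with `μ₆`, `μ₄`). HONEST FRAMING: statements about `2 × 2` matrices over a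
commutative ring with an involution; nothing here constructs a derived category or an abelian variety, and
nothing here says that HC, HC_CM or HC_AV holds.

## Source, verbatim (held text `paper:arxiv-alg-geom_9712017` = the Izv. Math. translation, journal
numbering; `pNNNN:Lnn` = chunk : line of the held text)

[Orlov2002DerivedAbelian] D. O. Orlov, *Derived categories of coherent sheaves on abelian varieties and
equivalences between them*, Izv. Math. 66:3 (2002) 569–594. p0008:L27–56 (before **Def. 2.17**): a
morphism `f : A × Â → B × B̂` is a matrix `f = (α β; γ δ)` ("`α` maps `A` to `B`, `β` maps `Â` to `B`,
`γ` maps `A` to `B̂`, and `δ` maps `Â` to `B̂`"); "Each morphism `f` determines two other morphisms `f̂`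
and `f̃` from `B × B̂` to `A × Â` whose matrices are `f̂ = (δ̂ β̂; γ̂ α̂)`, `f̃ = (δ̂ −β̂; −γ̂ α̂)`. We
define a set `U(A × Â, B × B̂)` as the subset of all `f` in `Iso(A × Â, B × B̂)` such that `f̃`
coincides with the inverse to `f` … If `B = A`, we denote this set by `U(A × Â)`. We note that
`U(A × Â)` is a subgroup in `Aut(A × Â)`." **Definition 2.17** (p0008:L58–59): "An isomorphism
`f : A × Â ⥲ B × B̂` is called isometric if it belongs to `U(A × Â, B × B̂)`." **Example 4.15**
(p0013:L52–55): "`A = Eⁿ`, where `E` is an elliptic curve without complex multiplication. Then the group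
`U(A × Â)` is isomorphic to `Sp_{2n}(ℤ)`." **Example 4.16** (p0013:L86–92, L109–112): "Consider an
abelian variety `A` with the endomorphism ring `End(A) = ℤ`. … The group `U(A × Â)` coincides with the
congruence subgroup `Γ₀(N) ⊂ SL(2, ℤ)`. … We now additionally assume that the abelian variety `A` is
principally polarized, that is, we have `N = 1`. … Moreover, the group `U(A × Â)` is isomorphic to
`SL(2, ℤ)`." (Orlov's `γ_A : Auteq D^b(A) ↠ U(A × Â)`, kernel `ℤ ⊕ (A × Â)_k` — Prop. 3.3, Thm. 4.14,
(4.4), `k = k̄`, `char k = 0` — is what makes `U` the group of autoequivalence frames; NOT typed here.)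

## The matrix model (the cell's reading of Def. 2.17 for an elliptic curve; NOT a quotation)

`E` an elliptic curve, `R := End(E)` commutative, `Ê` identified with `E` by the principal polarisation:
the entries of `f = (a b; c d) ∈ End(E × Ê)` become elements of `R`, the hat `x ↦ x̂` becomes the Rosati
involution `σ : R → R` (a ring involution since `R` is commutative: the identity for `R = ℤ`, complex
conjugation for an imaginary-quadratic order `R = ℤ[ω] ⊂ ℂ`), and `f̃ = (d̂ −b̂; −ĉ â) = adj(σ(f))`.
So `f ∈ U(E × Ê) ⟺ f · adj(σ(f)) = 1`, in Lean `g * adjugate (g.map σ) = 1` — the hypothesis `hg` of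
every theorem below (no named predicate is introduced; a one-sided inverse of a square matrix over a
commutative ring is two-sided).

## Results (all PROVED: no named fact, no `sorry`; imports Mathlib + HarnessLib only)

* `orlovIsometric_entries / _det_mul_map_det / _map_eq_smul`: entry equations, `det g · σ(det g) = 1`,
  `σ(g) = σ(det g) · g`; `orlovIsometric_of_smul_intCast / _of_intCast / _mul_intCast`: `μ · SL₂(ℤ) ⊆ U` and stability of
  `U` under right multiplication by `SL(2, ℤ)`.
* MAIN `orlovIsometric_iff_exists_smul_specialLinearGroup`: `σ` an involution of a ring of
  characteristic `0` with `Fix(σ) ⊆ ℤ · 1` and norms `x σ(x) ∈ ℕ · 1` vanishing only at `0` ⟹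
  (`g · adj(σ g) = 1 ⟺ g = λ · h`, `λ σ(λ) = 1`, `h ∈ SL(2, ℤ)`), i.e. `U = μ · SL₂(ℤ)` with
  `μ = {λ : λ σ(λ) = 1}`. Proof: Euclid on the first row (descent on the norm of `g 0 1`, using the
  `SL(2, ℤ)`-stability); the case `g 0 1 = 0` is read off from the entry equations.
* `orlovIsometric_ringHomId_iff_det`: `σ = id` (`End = ℤ`): `g ∈ U ⟺ det g = 1` (Ex. 4.16, `N = 1`).

NOT here: Orlov's sequence (4.4) and `γ_A`; the spinor description `Spin(A) → U(A × Â)` of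
[GolyshevLuntsOrlov2001MirrorAV] §4.3; anything about `Eⁿ`, `n ≥ 2` (Example 4.15's `Sp_{2n}(ℤ)`).
-/

namespace Summit.Ventures.HSemireg

open Matrix
open scoped MatrixGroups

variable {R : Type*} [CommRing R]

/-- `det (σ g) = σ (det g)` for the entrywise image of a matrix under a ring map. [folklore] -/
private theorem det_map_ringHom (σ : R →+* R) (g : Matrix (Fin 2) (Fin 2) R) : (g.map σ).det = σ g.det := by
  simpa [RingHom.mapMatrix_apply] using (RingHom.map_det σ g).symm

/-- Integer matrices are fixed entrywise by any ring endomorphism. [folklore] -/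
private theorem map_intCast_map (σ : R →+* R) (k : Matrix (Fin 2) (Fin 2) ℤ) :
    (k.map (Int.castRingHom R)).map σ = k.map (Int.castRingHom R) := by
  ext i j
  simp

/-- `det` commutes with the coercion of an integer matrix. [folklore] -/
private theorem det_intCast_map (k : Matrix (Fin 2) (Fin 2) ℤ) :
    (k.map (Int.castRingHom R)).det = (k.det : R) := by
  simpa [RingHom.mapMatrix_apply] using (RingHom.map_det (Int.castRingHom R) k).symm

/-- In a ring of characteristic `0` with an endomorphism `σ` whose fixed elements are integers, the
only natural number that is a unit is `1` (its inverse is `σ`-fixed, hence an integer).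
[folklore] -/
private theorem natCast_eq_one_of_isUnit [CharZero R] {σ : R →+* R}
    (hfix : ∀ x : R, σ x = x → ∃ m : ℤ, (m : R) = x) {n : ℕ} (hn : IsUnit (n : R)) : n = 1 := by
  obtain ⟨v, hv⟩ := hn.exists_right_inv
  have hv' : (n : R) * σ v = 1 := by simpa using congrArg σ hv
  have hfixv : σ v = v := by
    calc σ v = (n : R) * v * σ v := by rw [hv, one_mul]
      _ = v * ((n : R) * σ v) := by ring
      _ = v := by rw [hv', mul_one]
  obtain ⟨m, hm⟩ := hfix v hfixv
  have h1 : ((n : ℤ) : R) * (m : R) = 1 := by rw [hm]; exact_mod_cast hv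
  have h2 : ((n : ℤ) * m : ℤ) = 1 := by exact_mod_cast h1
  have h3 : (n : ℤ) = 1 := Int.eq_one_of_mul_eq_one_right (by positivity) h2
  exact_mod_cast h3

variable {σ : R →+* R} {g : Matrix (Fin 2) (Fin 2) R}

/-- The four entry equations of `g · adj(σ g) = 1` for `g = (a b; c d)`:
`a σ(d) − b σ(c) = 1`, `b σ(a) − a σ(b) = 0`, `c σ(d) − d σ(c) = 0`, `d σ(a) − c σ(b) = 1`
(so `a σ(b)` and `c σ(d)` are `σ`-symmetric — "real" in the CM model).
[cite: Orlov2002DerivedAbelian, Def 2.17] -/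
theorem orlovIsometric_entries (hg : g * adjugate (g.map σ) = 1) :
    g 0 0 * σ (g 1 1) - g 0 1 * σ (g 1 0) = 1 ∧ g 0 1 * σ (g 0 0) - g 0 0 * σ (g 0 1) = 0 ∧
      g 1 0 * σ (g 1 1) - g 1 1 * σ (g 1 0) = 0 ∧ g 1 1 * σ (g 0 0) - g 1 0 * σ (g 0 1) = 1 := by
  have h := fun i j => congrFun (congrFun hg i) j
  have h00 := h 0 0
  have h01 := h 0 1
  have h10 := h 1 0
  have h11 := h 1 1
  simp [Matrix.mul_apply, Fin.sum_univ_two, adjugate_fin_two] at h00 h01 h10 h11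
  refine ⟨?_, ?_, ?_, ?_⟩
  · linear_combination h00
  · linear_combination h01
  · linear_combination h10
  · linear_combination h11

/-- `det g · σ(det g) = 1` for an isometric `g` (take determinants; `det adj = det` for `2 × 2`).
[cite: Orlov2002DerivedAbelian, Def 2.17] -/
theorem orlovIsometric_det_mul_map_det (hg : g * adjugate (g.map σ) = 1) : g.det * σ g.det = 1 := by
  have h := congrArg Matrix.det hg
  rwa [det_mul, det_adjugate, det_map_ringHom, Fintype.card_fin, det_one,
    show (2 : ℕ) - 1 = 1 from rfl, pow_one] at h

/-- The determinant of an isometric matrix is a unit. [cite: Orlov2002DerivedAbelian, Def 2.17] -/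
theorem orlovIsometric_isUnit_det (hg : g * adjugate (g.map σ) = 1) : IsUnit g.det :=
  IsUnit.of_mul_eq_one _ (orlovIsometric_det_mul_map_det hg)

/-- `σ(g) = σ(det g) · g` for an isometric `g` (multiply `g · adj(σ g) = 1` by `σ g` on the right).
[cite: Orlov2002DerivedAbelian, Def 2.17] -/
theorem orlovIsometric_map_eq_smul (hg : g * adjugate (g.map σ) = 1) : g.map σ = σ g.det • g := by
  have h : g * adjugate (g.map σ) * g.map σ = g.map σ := by
    rw [hg, Matrix.one_mul]
  rw [Matrix.mul_assoc, adjugate_mul, det_map_ringHom, Matrix.mul_smul, Matrix.mul_one] at h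
  exact h.symm

/-- Entrywise form of `map_eq_smul`: `σ(g i j) = σ(det g) · g i j`.
[cite: Orlov2002DerivedAbelian, Def 2.17] -/
theorem orlovIsometric_map_apply (hg : g * adjugate (g.map σ) = 1) (i j : Fin 2) : σ (g i j) = σ g.det * g i j := by
  have h := congrFun (congrFun (orlovIsometric_map_eq_smul hg) i) j
  simpa [Matrix.smul_apply] using h

/-- Stability under right multiplication by integer matrices of determinant `1`
(`σ` fixes integers and `adj(XY) = adj(Y) adj(X)`). [cite: Orlov2002DerivedAbelian, Def 2.17] -/
theorem orlovIsometric_mul_intCast (hg : g * adjugate (g.map σ) = 1) {k : Matrix (Fin 2) (Fin 2) ℤ} (hk : k.det = 1) :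
    g * k.map (Int.castRingHom R) * adjugate ((g * k.map (Int.castRingHom R)).map σ) = 1 := by
  rw [Matrix.map_mul, map_intCast_map, adjugate_mul_distrib, Matrix.mul_assoc,
    ← Matrix.mul_assoc (k.map (Int.castRingHom R)), mul_adjugate, det_intCast_map, hk, Int.cast_one,
    one_smul, Matrix.one_mul, hg]

/-- `λ · h` is isometric whenever `λ σ(λ) = 1` and `h` is an integer matrix of determinant `1`
(the easy inclusion `μ · SL₂(ℤ) ⊆ U`). [cite: Orlov2002DerivedAbelian, Def 2.17] -/
theorem orlovIsometric_of_smul_intCast (σ : R →+* R) {l : R} (hl : l * σ l = 1) {k : Matrix (Fin 2) (Fin 2) ℤ}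
    (hk : k.det = 1) :
    l • k.map (Int.castRingHom R) * adjugate ((l • k.map (Int.castRingHom R)).map σ) = 1 := by
  have h1 : (l • k.map (Int.castRingHom R)).map σ = σ l • k.map (Int.castRingHom R) := by
    ext i j
    simp
  rw [h1, adjugate_smul, Fintype.card_fin, show (2 : ℕ) - 1 = 1 from rfl, pow_one, Matrix.smul_mul,
    Matrix.mul_smul, mul_adjugate, det_intCast_map, hk, Int.cast_one, one_smul, smul_smul, hl, one_smul]

/-- `SL(2, ℤ) ⊆ U`: every integer matrix of determinant `1` is isometric (for `End(A) = ℤ`, `N = 1`,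
Orlov prints `U(A × Â) ≅ SL(2, ℤ)`). [cite: Orlov2002DerivedAbelian, Ex 4.16] -/
theorem orlovIsometric_of_intCast (σ : R →+* R) {k : Matrix (Fin 2) (Fin 2) ℤ} (hk : k.det = 1) :
    k.map (Int.castRingHom R) * adjugate ((k.map (Int.castRingHom R)).map σ) = 1 := by
  simpa using orlovIsometric_of_smul_intCast σ (l := (1 : R)) (by simp) hk

/-- **MAIN (`U = μ · SL₂(ℤ)`).** Let `σ` be a ring involution of a commutative ring `R` of
characteristic `0` whose fixed elements are integers, such that every `x σ(x)` is a natural number and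
`x σ(x) = 0` only for `x = 0` (e.g. complex conjugation on an order of an imaginary-quadratic field).
Then every Orlov-isometric `g` is `λ · h` with `λ σ(λ) = 1` and `h ∈ SL(2, ℤ)`. Proof by Euclid's
algorithm on the first row (descent on the norm of `g 0 1`). DERIVED HERE (the cell's reading (Q1) of
Orlov's Def. 2.17 [cite: Orlov2002DerivedAbelian, Def 2.17] for a CM elliptic curve — not a printed
statement); consistent with the printed Ex. 4.16 (`End = ℤ`, `N = 1`: `U ≅ SL(2, ℤ)`). -/
theorem orlovIsometric_exists_smul_specialLinearGroup [CharZero R] (hσ : ∀ x, σ (σ x) = x)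
    (hfix : ∀ x : R, σ x = x → ∃ m : ℤ, (m : R) = x) (hnorm : ∀ x : R, ∃ n : ℕ, x * σ x = n)
    (hdef : ∀ x : R, x * σ x = 0 → x = 0) (hg : g * adjugate (g.map σ) = 1) :
    ∃ (l : R) (k : SL(2, ℤ)), l * σ l = 1 ∧
      g = l • (k : Matrix (Fin 2) (Fin 2) ℤ).map (Int.castRingHom R) := by
  choose N hN using hnorm
  suffices H : ∀ (n : ℕ) (g : Matrix (Fin 2) (Fin 2) R), g * adjugate (g.map σ) = 1 → N (g 0 1) = n →
      ∃ (l : R) (k : SL(2, ℤ)), l * σ l = 1 ∧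
        g = l • (k : Matrix (Fin 2) (Fin 2) ℤ).map (Int.castRingHom R) from H _ g hg rfl
  intro n
  refine Nat.strong_induction_on n ?_
  intro n ih g hg hn
  obtain ⟨e00, e01, e10, e11⟩ := orlovIsometric_entries hg
  by_cases hb : g 0 1 = 0
  · -- `g = (a 0; c d)`: then `a σ(d) = 1 = d σ(a)`, `a σ(a) ∈ ℕ` is a unit hence `1`, `d = a`,
    -- and `c σ(d) = c / a` is `σ`-fixed hence an integer `m`: `g = a · (1 0; m 1)`.
    simp only [hb, map_zero, mul_zero, zero_mul, sub_zero] at e00 e11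
    have hσa : IsUnit (σ (g 0 0)) := IsUnit.of_mul_eq_one_right _ e11
    have ha : g 0 0 * σ (g 0 0) = 1 := by
      have hu : IsUnit ((N (g 0 0) : ℕ) : R) := by
        rw [← hN]
        exact (IsUnit.of_mul_eq_one _ e00).mul hσa
      rw [hN, natCast_eq_one_of_isUnit hfix hu, Nat.cast_one]
    have hd : g 1 1 = g 0 0 := by
      calc g 1 1 = g 1 1 * (σ (g 0 0) * g 0 0) := by rw [mul_comm (σ (g 0 0)) (g 0 0), ha, mul_one]
        _ = g 1 1 * σ (g 0 0) * g 0 0 := by ring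
        _ = g 0 0 := by rw [e11, one_mul]
    have ht : σ (g 1 0 * σ (g 1 1)) = g 1 0 * σ (g 1 1) := by
      rw [map_mul, hσ]
      linear_combination (-1 : R) * e10
    obtain ⟨m, hm⟩ := hfix _ ht
    have hc : g 1 0 = g 0 0 * (m : R) := by
      rw [hm]
      calc g 1 0 = g 1 0 * (g 0 0 * σ (g 1 1)) := by rw [e00, mul_one]
        _ = g 0 0 * (g 1 0 * σ (g 1 1)) := by ring
    refine ⟨g 0 0, ⟨!![1, 0; m, 1], by simp [Matrix.det_fin_two_of]⟩, ha, ?_⟩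
    ext i j
    fin_cases i <;> fin_cases j <;> simp [hb, hc, hd]
  · -- Euclid step: replace `(a, b)` by `(b, a - q b)` with `q = ⌊m / N b⌋`, `m = a σ(b) ∈ ℤ`.
    have hNb : 0 < N (g 0 1) := by
      rcases Nat.eq_zero_or_pos (N (g 0 1)) with h0 | h0
      · exact absurd (hdef _ (by rw [hN, h0, Nat.cast_zero])) hb
      · exact h0
    have hfixab : σ (g 0 0 * σ (g 0 1)) = g 0 0 * σ (g 0 1) := by
      rw [map_mul, hσ, orlovIsometric_map_apply hg 0 0, orlovIsometric_map_apply hg 0 1]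
      ring
    obtain ⟨m, hm⟩ := hfix _ hfixab
    have hm' : g 0 1 * σ (g 0 0) = (m : R) := by
      have h := hfixab
      rw [map_mul, hσ] at h
      rw [hm]
      linear_combination h
    have hNN : ((N (g 0 0) : ℤ)) * (N (g 0 1) : ℤ) = m * m := by
      have h : ((N (g 0 0) : ℕ) : R) * ((N (g 0 1) : ℕ) : R) = (m : R) * (m : R) := by
        calc ((N (g 0 0) : ℕ) : R) * ((N (g 0 1) : ℕ) : R)
            = (g 0 0 * σ (g 0 0)) * (g 0 1 * σ (g 0 1)) := by rw [hN, hN]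
          _ = (g 0 0 * σ (g 0 1)) * (g 0 1 * σ (g 0 0)) := by ring
          _ = (m : R) * (m : R) := by rw [← hm, hm']
      exact_mod_cast h
    have hnb0 : (0 : ℤ) < (N (g 0 1) : ℤ) := by exact_mod_cast hNb
    set q : ℤ := m / (N (g 0 1) : ℤ) with hq_def
    have hr0 : 0 ≤ m % (N (g 0 1) : ℤ) := Int.emod_nonneg _ hnb0.ne'
    have hr1 : m % (N (g 0 1) : ℤ) < (N (g 0 1) : ℤ) := Int.emod_lt_of_pos _ hnb0
    have hr : m % (N (g 0 1) : ℤ) = m - (N (g 0 1) : ℤ) * q := by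
      rw [hq_def]
      exact Int.emod_def _ _
    -- the column operation, an element of `SL(2, ℤ)`
    set k : Matrix (Fin 2) (Fin 2) ℤ := !![0, 1; -1, -q] with hk_def
    have hk : k.det = 1 := by simp [hk_def, Matrix.det_fin_two_of]
    have hg' := orlovIsometric_mul_intCast hg hk
    have h01 : (g * k.map (Int.castRingHom R)) 0 1 = g 0 0 - (q : R) * g 0 1 := by
      simp [hk_def, Matrix.mul_apply, Fin.sum_univ_two]
      ring
    -- norm of the new entry, as an integer
    have hN' : ((N (g 0 0 - (q : R) * g 0 1) : ℤ)) =
        (N (g 0 0) : ℤ) - 2 * q * m + q ^ 2 * (N (g 0 1) : ℤ) := by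
      have h : ((N (g 0 0 - (q : R) * g 0 1) : ℕ) : R) =
          ((N (g 0 0) : ℕ) : R) - 2 * (q : R) * (m : R) + (q : R) ^ 2 * ((N (g 0 1) : ℕ) : R) := by
        rw [← hN, ← hN, ← hN, map_sub, map_mul, map_intCast]
        linear_combination (-(q : R)) * hm' + (q : R) * hm
      exact_mod_cast h
    have hlt : N (g 0 0 - (q : R) * g 0 1) < N (g 0 1) := by
      have key : ((N (g 0 0 - (q : R) * g 0 1) : ℤ)) * (N (g 0 1) : ℤ) =
          (m % (N (g 0 1) : ℤ)) * (m % (N (g 0 1) : ℤ)) := by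
        rw [hN', hr]
        linear_combination hNN
      have hr2 : (m % (N (g 0 1) : ℤ)) * (m % (N (g 0 1) : ℤ)) < (N (g 0 1) : ℤ) * (N (g 0 1) : ℤ) := by
        nlinarith [hr0, hr1]
      have h3 : ((N (g 0 0 - (q : R) * g 0 1) : ℤ)) * (N (g 0 1) : ℤ) <
          (N (g 0 1) : ℤ) * (N (g 0 1) : ℤ) := by
        rw [key]
        exact hr2
      have h4 : ((N (g 0 0 - (q : R) * g 0 1) : ℤ)) < (N (g 0 1) : ℤ) :=
        lt_of_mul_lt_mul_right h3 hnb0.le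
      exact_mod_cast h4
    have hlt' : N (g 0 0 - (q : R) * g 0 1) < n := by
      rw [← hn]
      exact hlt
    obtain ⟨l, k', hl, hgk⟩ := ih _ hlt' _ hg' (by rw [h01])
    -- undo the column operation: `g = (g k) k⁻¹ = λ · (k' k⁻¹)`
    obtain ⟨kS, hkS⟩ : ∃ kS : SL(2, ℤ), (kS : Matrix (Fin 2) (Fin 2) ℤ) = k := ⟨⟨k, hk⟩, rfl⟩
    refine ⟨l, k' * kS⁻¹, hl, ?_⟩
    have hK : g = g * k.map (Int.castRingHom R) * (adjugate k).map (Int.castRingHom R) := by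
      rw [Matrix.mul_assoc, ← RingHom.mapMatrix_apply (Int.castRingHom R) (adjugate k),
        RingHom.map_adjugate, RingHom.mapMatrix_apply, mul_adjugate, det_intCast_map, hk,
        Int.cast_one, one_smul, Matrix.mul_one]
    rw [hK, hgk, Matrix.SpecialLinearGroup.coe_mul, Matrix.SpecialLinearGroup.coe_inv, hkS,
      Matrix.map_mul, Matrix.smul_mul]


/-- **MAIN, iff form: `U = μ · SL₂(ℤ)`.** Under the hypotheses of
`orlovIsometric_exists_smul_specialLinearGroup` (involution `σ`, fixed elements integers, norms in
`ℕ` and definite, characteristic `0`): `g · adj(σ g) = 1 ⟺ g = λ · h`, `λ σ(λ) = 1`, `h ∈ SL(2, ℤ)`.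
DERIVED HERE — the cell's reading (Q1) of Orlov's Def. 2.17 [cite: Orlov2002DerivedAbelian, Def 2.17];
not a printed statement. -/
theorem orlovIsometric_iff_exists_smul_specialLinearGroup [CharZero R] {σ : R →+* R}
    (hσ : ∀ x, σ (σ x) = x) (hfix : ∀ x : R, σ x = x → ∃ m : ℤ, (m : R) = x)
    (hnorm : ∀ x : R, ∃ n : ℕ, x * σ x = n) (hdef : ∀ x : R, x * σ x = 0 → x = 0)
    (g : Matrix (Fin 2) (Fin 2) R) :
    g * adjugate (g.map σ) = 1 ↔ ∃ (l : R) (k : SL(2, ℤ)), l * σ l = 1 ∧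
      g = l • (k : Matrix (Fin 2) (Fin 2) ℤ).map (Int.castRingHom R) := by
  constructor
  · exact fun hg => orlovIsometric_exists_smul_specialLinearGroup hσ hfix hnorm hdef hg
  · rintro ⟨l, k, hl, rfl⟩
    exact orlovIsometric_of_smul_intCast σ hl k.2

/-- **`End(A) = ℤ`, principal polarisation.** With `σ = id` (every endomorphism is an integer, the
Rosati involution is trivial) a matrix is Orlov-isometric iff its determinant is `1`, i.e.
`U ≅ SL(2, R)`; for `R = ℤ` this is Orlov's "the group `U(A × Â)` is isomorphic to `SL(2, ℤ)`".
[cite: Orlov2002DerivedAbelian, Ex 4.16] -/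
theorem orlovIsometric_ringHomId_iff_det (g : Matrix (Fin 2) (Fin 2) R) :
    g * adjugate (g.map (RingHom.id R)) = 1 ↔ g.det = 1 := by
  have hmap : g.map (RingHom.id R) = g := by
    ext i j
    simp
  rw [hmap, mul_adjugate]
  constructor
  · intro h
    have h00 := congrFun (congrFun h 0) 0
    simpa using h00
  · intro h
    rw [h, one_smul]

end Summit.Ventures.HSemireg
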